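import Summits.Ventures.PercRepro.Graph

/-!
# The (P) functional of a skeleton (p6, gen 16; mine-3 §26 (a) / §29)

A **skeleton** is a multigraph `G` with a probe vertex `c`, an edge set `F ⊆ E` in play, and a
vertex structure at every vertex given by two numbers `x v` and `K v` (the probe's structure
`(Z_A, K_A)` is `(x c, K c)`).  For a configuration `ω` with open edges inside `F` write
`Γ(ω)` for the open cluster of `c`, and for every open cluster `R` put `X_R = ∏_{v ∈ R} x v`.
The **(P) functional** (mine-3 §26 (a), §29) is the configuration sum

`(P) = ∑_{ω ⊆ F} [ N_c(ω)·(1 − 2 X_c(ω)) + K_c(ω)·n̄(ω^c) ]`,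

where `N_c(ω) = ∏_{R ∌ c} (2 − X_R)`, `X_c(ω) = X_{Γ(ω)}`, `K_c(ω) = ∏_{v ∈ Γ(ω)} K v`,
`n̄(ω) = ∏_{R} (2 − X_R)` (over all clusters, `c`'s included) and `ω^c` is the complement of
`ω` inside `F`.  The first summand is `(Ya − Z)(ω)` and the second `K(ω)·n̄(ω^c)` in the
notation of the note: every degree-2 tensor-Bernstein coefficient of the C-028 slack of a
symmetric marked multigraph is an instance of `(P)` (§26 (a)), and `(P) ≥ 0` for all band
states is CONJECTURE (P).

This file holds the definitions and the elementary facts about finite clusters used by the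
merge lemma (`C026PFunMerge`) and the half-monotonicity lemma / THEOREM R (`C026PFunHalfEM`).
-/

namespace PercRepro

/-- The one-state slack `Δ(z, κ) = 1 − 2z + κ·(2 − z)` (mine-3 §29 (a)). -/
def slackOne (z κ : ℝ) : ℝ := 1 - 2 * z + κ * (2 - z)

/-- The lower corner `K_min(z) = max 0 ((2z − 1)/(2 − z))` of the band at `x = z`. -/
noncomputable def kMin (z : ℝ) : ℝ := max 0 ((2 * z - 1) / (2 - z))

/-- `Δ(z, K_min z) ≥ 0` for `z ≤ 1`: the corner lies in the band. -/
theorem slackOne_kMin_nonneg {z : ℝ} (hz : z ≤ 1) : 0 ≤ slackOne z (kMin z) := by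
  unfold slackOne kMin
  have h2 : 0 < 2 - z := by linarith
  rcases le_or_gt ((2 * z - 1) / (2 - z)) 0 with h | h
  · rw [max_eq_left h]
    have : 2 * z - 1 ≤ 0 := by
      by_contra hc
      exact absurd (div_pos (lt_of_not_ge hc) h2) (not_lt.mpr h)
    linarith
  · rw [max_eq_right h.le]
    rw [div_mul_cancel₀ _ h2.ne']
    linarith

/-- `Δ` is nondecreasing in `κ` when `z ≤ 2`. -/
theorem slackOne_mono_right {z κ κ' : ℝ} (hz : z ≤ 2) (h : κ ≤ κ') :
    slackOne z κ ≤ slackOne z κ' := by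
  unfold slackOne
  nlinarith

/-- `Δ(z, κ) ≥ 0` whenever `z ≤ 1` and `κ ≥ K_min z` (the band). -/
theorem slackOne_nonneg_of_kMin_le {z κ : ℝ} (hz : z ≤ 1) (h : kMin z ≤ κ) :
    0 ≤ slackOne z κ :=
  (slackOne_kMin_nonneg hz).trans (slackOne_mono_right (by linarith) h)

namespace MultiGraph

open Finset

variable {V E : Type*} [Fintype V] (G : MultiGraph V E)

/-! ### Finite clusters -/

open Classical in
/-- The open cluster of `v` in `ω` as a `Finset`. -/
noncomputable def clusterF (ω : Config E) (v : V) : Finset V := univ.filter (G.Conn ω v)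

variable {G}

/-- Membership in a finite cluster. -/
@[simp] theorem mem_clusterF {ω : Config E} {u v : V} : u ∈ G.clusterF ω v ↔ G.Conn ω v u := by
  unfold clusterF
  simp

/-- A vertex lies in its own cluster. -/
theorem self_mem_clusterF (ω : Config E) (v : V) : v ∈ G.clusterF ω v :=
  mem_clusterF.2 (Conn.refl G ω v)

/-- Every cluster is nonempty. -/
theorem clusterF_nonempty (ω : Config E) (v : V) : (G.clusterF ω v).Nonempty :=
  ⟨v, self_mem_clusterF ω v⟩

/-- Connected vertices have the same cluster. -/
theorem clusterF_eq_of_conn {ω : Config E} {u v : V} (h : G.Conn ω u v) :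
    G.clusterF ω u = G.clusterF ω v := by
  ext w
  simp only [mem_clusterF]
  exact ⟨fun hw => h.symm.trans hw, fun hw => h.trans hw⟩

/-- Equal clusters come from connected vertices. -/
theorem conn_of_clusterF_eq {ω : Config E} {u v : V} (h : G.clusterF ω u = G.clusterF ω v) :
    G.Conn ω u v := by
  have : v ∈ G.clusterF ω u := h ▸ self_mem_clusterF ω v
  exact mem_clusterF.1 this

/-- `clusterF ω u = clusterF ω v ↔ u ↔ v`. -/
theorem clusterF_eq_iff {ω : Config E} {u v : V} :
    G.clusterF ω u = G.clusterF ω v ↔ G.Conn ω u v :=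
  ⟨conn_of_clusterF_eq, clusterF_eq_of_conn⟩

/-- Two different clusters are disjoint. -/
theorem disjoint_clusterF_of_not_conn {ω : Config E} {u v : V} (h : ¬ G.Conn ω u v) :
    Disjoint (G.clusterF ω u) (G.clusterF ω v) := by
  rw [Finset.disjoint_left]
  intro w hwu hwv
  exact h ((mem_clusterF.1 hwu).trans (mem_clusterF.1 hwv).symm)

/-- If no edge is open, every cluster is a singleton. -/
theorem clusterF_eq_singleton_of_forall_false {ω : Config E} (h : ∀ e, ω e = false) (v : V) :
    G.clusterF ω v = {v} := by
  ext w
  simp only [mem_clusterF, Finset.mem_singleton]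
  constructor
  · intro hw
    exact eq_of_conn_of_forall_eq_false h hw
  · rintro rfl
    exact Conn.refl G ω w

/-! ### The set of clusters -/

section Clusters

variable [DecidableEq V] (G)

open Classical in
/-- The set of open clusters of `ω`. -/
noncomputable def clusters (ω : Config E) : Finset (Finset V) := univ.image (G.clusterF ω)

variable {G}

/-- Membership in the set of clusters. -/
theorem mem_clusters {ω : Config E} {R : Finset V} :
    R ∈ G.clusters ω ↔ ∃ v, G.clusterF ω v = R := by
  unfold clusters
  simp

/-- The cluster of a vertex is a cluster. -/
theorem clusterF_mem_clusters (ω : Config E) (v : V) : G.clusterF ω v ∈ G.clusters ω :=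
  mem_clusters.2 ⟨v, rfl⟩

/-- A vertex of a cluster `R` has `R` as its cluster. -/
theorem clusterF_eq_of_mem {ω : Config E} {R : Finset V} (hR : R ∈ G.clusters ω) {v : V}
    (hv : v ∈ R) : G.clusterF ω v = R := by
  obtain ⟨u, rfl⟩ := mem_clusters.1 hR
  exact clusterF_eq_of_conn (mem_clusterF.1 hv).symm

end Clusters

/-! ### The products -/

section Products

variable (G)

omit [Fintype V] in
/-- Every factor `2 − X_R` lies in `[1, 2]` when the cells lie in `[0, 1]`. -/
theorem one_le_two_sub_prod {x : V → ℝ} (hx : ∀ v, 0 ≤ x v ∧ x v ≤ 1) (R : Finset V) :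
    1 ≤ 2 - ∏ v ∈ R, x v := by
  have h0 : 0 ≤ ∏ v ∈ R, x v := Finset.prod_nonneg fun v _ => (hx v).1
  have h1 : ∏ v ∈ R, x v ≤ 1 := Finset.prod_le_one (fun v _ => (hx v).1) (fun v _ => (hx v).2)
  linarith

/-- `X_c(ω)`: the `x`-product over the cluster of `c`. -/
noncomputable def xCluster (x : V → ℝ) (c : V) (ω : Config E) : ℝ :=
  ∏ v ∈ G.clusterF ω c, x v

/-- `K_c(ω)`: the `K`-product over the cluster of `c`. -/
noncomputable def kCluster (K : V → ℝ) (c : V) (ω : Config E) : ℝ :=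
  ∏ v ∈ G.clusterF ω c, K v

variable {G}

/-- `0 ≤ X_c ≤ 1` for cells in `[0, 1]`. -/
theorem xCluster_mem {x : V → ℝ} (hx : ∀ v, 0 ≤ x v ∧ x v ≤ 1) (c : V) (ω : Config E) :
    0 ≤ G.xCluster x c ω ∧ G.xCluster x c ω ≤ 1 :=
  ⟨Finset.prod_nonneg fun v _ => (hx v).1,
    Finset.prod_le_one (fun v _ => (hx v).1) (fun v _ => (hx v).2)⟩

/-- `K_c ≥ 0` for nonnegative `K`. -/
theorem kCluster_nonneg {K : V → ℝ} (hK : ∀ v, 0 ≤ K v) (c : V) (ω : Config E) :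
    0 ≤ G.kCluster K c ω :=
  Finset.prod_nonneg fun v _ => hK v

/-- `K_c` is monotone in `K` on nonnegative cells. -/
theorem kCluster_mono {K K' : V → ℝ} (hK : ∀ v, 0 ≤ K v) (h : ∀ v, K v ≤ K' v) (c : V)
    (ω : Config E) : G.kCluster K c ω ≤ G.kCluster K' c ω :=
  Finset.prod_le_prod (fun v _ => hK v) (fun v _ => h v)

variable [DecidableEq V] (G)

/-- `n̄(ω) = ∏_{clusters R} (2 − X_R)` (the `a ≁ b` probability in the symmetric dictionary). -/
noncomputable def nbar (x : V → ℝ) (ω : Config E) : ℝ :=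
  ∏ R ∈ G.clusters ω, (2 - ∏ v ∈ R, x v)

/-- `N_c(ω)`: the product of `2 − X_R` over the clusters not containing `c`. -/
noncomputable def nbarOff (x : V → ℝ) (c : V) (ω : Config E) : ℝ :=
  ∏ R ∈ (G.clusters ω).erase (G.clusterF ω c), (2 - ∏ v ∈ R, x v)

/-- `n̄(ω) = (2 − X_c(ω)) · N_c(ω)`. -/
theorem nbar_eq_mul_nbarOff (x : V → ℝ) (c : V) (ω : Config E) :
    G.nbar x ω = (2 - G.xCluster x c ω) * G.nbarOff x c ω := by
  unfold nbar nbarOff xCluster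
  rw [← Finset.mul_prod_erase _ _ (clusterF_mem_clusters ω c)]

variable {G}

/-- `n̄ ≥ 1 > 0` for cells in `[0, 1]`. -/
theorem one_le_nbar {x : V → ℝ} (hx : ∀ v, 0 ≤ x v ∧ x v ≤ 1) (ω : Config E) :
    1 ≤ G.nbar x ω := by
  unfold nbar
  exact Finset.one_le_prod fun R _ => one_le_two_sub_prod hx R

/-- `n̄ ≥ 0` for cells in `[0, 1]`. -/
theorem nbar_nonneg {x : V → ℝ} (hx : ∀ v, 0 ≤ x v ∧ x v ≤ 1) (ω : Config E) :
    0 ≤ G.nbar x ω :=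
  zero_le_one.trans (one_le_nbar hx ω)

/-- `N_c ≥ 1 > 0` for cells in `[0, 1]`. -/
theorem one_le_nbarOff {x : V → ℝ} (hx : ∀ v, 0 ≤ x v ∧ x v ≤ 1) (c : V) (ω : Config E) :
    1 ≤ G.nbarOff x c ω := by
  unfold nbarOff
  exact Finset.one_le_prod fun R _ => one_le_two_sub_prod hx R

/-- `N_c ≥ 0` for cells in `[0, 1]`. -/
theorem nbarOff_nonneg {x : V → ℝ} (hx : ∀ v, 0 ≤ x v ∧ x v ≤ 1) (c : V) (ω : Config E) :
    0 ≤ G.nbarOff x c ω :=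
  zero_le_one.trans (one_le_nbarOff hx c ω)

end Products

/-! ### The (P) functional -/

section PFun

variable [DecidableEq V] [Fintype E] [DecidableEq E]

/-- The complement of a configuration inside the edge set `F`: `e` is open in `complIn F ω` iff
`e ∈ F` and `e` is closed in `ω`. -/
def complIn (F : Finset E) (ω : Config E) : Config E := fun e => decide (e ∈ F ∧ ω e = false)

/-- The configurations with open edges inside `F`. -/
def configsIn (F : Finset E) : Finset (Config E) := univ.filter fun ω => openEdges ω ⊆ F

/-- Membership in `configsIn`. -/
theorem mem_configsIn {F : Finset E} {ω : Config E} :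
    ω ∈ configsIn F ↔ ∀ e, ω e = true → e ∈ F := by
  unfold configsIn
  simp only [Finset.mem_filter, Finset.mem_univ, true_and]
  constructor
  · intro h e he
    exact h (mem_openEdges.2 he)
  · intro h e he
    exact h e (mem_openEdges.1 he)

variable (G)

/-- **The (P) functional** of the skeleton `(G, F)` with probe `c` and vertex structures
`(x v, K v)` (the probe's structure is `(x c, K c)`):
`∑_{ω ⊆ F} [ N_c(ω)·(1 − 2X_c(ω)) + K_c(ω)·n̄(ω^c) ]` (mine-3 §26 (a), §29). -/
noncomputable def pFun (c : V) (x K : V → ℝ) (F : Finset E) : ℝ :=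
  ∑ ω ∈ configsIn F,
    (G.nbarOff x c ω * (1 - 2 * G.xCluster x c ω) + G.kCluster K c ω * G.nbar x (complIn F ω))

end PFun

end MultiGraph

end PercRepro
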